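import Summits.ResolutionOfSingularities.ResolutionOfSingularities.Theorems.HilbertSamuelEliminationSigmaMaxModificationsCorridor3WLadderIsoKernelShadowNoetherian
import HarnessLib

/-!
# [OURS · L1 W4.2] KERNEL CENSUS — THE EXHAUSTION STEP: a non-dominating COARSENING of a valuation dominating an isolated point tower is a SHADOW,
# and (over a perfect ground field) its RESIDUAL valuation ring is not Noetherian

Crux chain w42 (`SigmaMaxModifications`, stmt-ResolutionOfSingularities-18506; conjunct `SigmaMaxModificationsCorridor3`, stmt-…-19249),
line `w_ladder`, registered stub `stub_isoSepRecurrent` of skeleton v8.8. Lead res-L1-w42-lead-1 (gen 6, closing edition of the census). Helper file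
`--supports stmt-ResolutionOfSingularities-19249`; kernel only (no definition, no named fact).

WHAT IS PROVED (§1 pure valuation algebra inside a field; §2 scheme level).
* `valuation_eq_one_of_le`, `valuation_lt_one_of_le`, `valuation_le_of_le` — units / centre / comparisons pass between `O ≤ O₁` (coarsening).
* `exists_unit_of_not_dominates` — a local subring `R ⊆ O₁` is not dominated by `O₁` iff some element of `𝔪(R)` is a unit of `O₁`.
* `le_locAtCentre_of_not_dominates` — if `O` dominates a chain of quadratic transforms `B n` along it and a coarsening `O₁ ⊇ O` does NOT dominate `B n₀`,
  then EVERY `B m` lies in `C = (B n₀)_{centre of O₁}` (the generators `x_m`, `m ≥ n₀`, are `O₁`-units, so the charts and their localisations stay in `C`).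
* `exists_residual_valuationSubring` — the residues of `C ∩ O` form a valuation ring `W` of `κ(C)` (the residual valuation of the composite `v = v₁ ∘ v̄`),
  in which residues of elements of `C ∩ 𝔪_O` are non-units.
* `isQuadraticTransformAlong_of_dominatesTower` — along ANY valuation ring dominating the tower every step is the quadratic transform (gen 5's dictionary).
* `false_of_isIsoPointTower_over_perfectField_of_coarsening_noetherian_residual` — **CENSUS EXHAUSTION STEP**: for an isolated E3 point tower over a
  maximal origin (integral stages; origin stage separated / quasi-compact / locally of finite type over a PERFECT field of characteristic `p`), a valuation
  ring `O` dominating the tower (`DominatesTower`) and a coarsening `O₁ ⊇ O` NOT dominating the stage-`n₀` local ring, the residual valuation ring of `O` on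
  `κ((𝒪_{X_{n₀},x_{n₀}})_{centre of O₁})` is NOT Noetherian (`…ShadowNoetherian`'s overring form on the chain from `n₀` on, against res-L1-w42-stub-2's
  satellite recurrence). With `…PerfectNoetherian` (a DOMINATING coarsening is not Noetherian) this is the formal core of the classification in
  `KERNEL-CENSUS-g6.md`: unscrewing any valuation dominating a hypothetical counterexample tower over a perfect field, every rank-one piece met — of `K(X)`
  or of the function field of the shadowing subvariety — has DENSE value group; curve shadows do not occur at all (`…CurveShadow`).

HONEST FRAMING. OURS plumbing over textbook valuation theory (composite valuations: Zariski–Samuel II Ch. VI §10; quadratic transforms: Cutkosky §2);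
nothing here is a statement of H. Hironaka's manuscript [Hironaka2017] nor of [CossartJannsenSaito2020] / [CossartPiltant2009]. AI-written; AI review is
weaker than expert review.
References: O. Zariski, P. Samuel, *Commutative Algebra* II, Ch. VI §10, App. 5 [ZariskiSamuel1960]; S. D. Cutkosky, resolution notes §2.1–2.2 [Cutkosky2014];
V. Cossart, O. Piltant, J. Algebra 321 (2009), ch. 3 I.9, ch. 4 II.4 [CossartPiltant2009].
-/

noncomputable section

set_option linter.dupNamespace false

open CategoryTheory AlgebraicGeometry TopologicalSpace IsLocalRing
open Summit.ResolutionOfSingularities.ResolutionOfSingularities.Theorems.CampaignW42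
open Summit.ResolutionOfSingularities.ResolutionOfSingularities.Theorems.SigmaMaxModificationsCorridor3
open Literature.AlgebraicGeometry.Resolution Literature.AlgebraicGeometry.CossartJannsenSaito2020
open Summit.ResolutionOfSingularities.ResolutionOfSingularities.Cruxes.SigmaMaxModifications.IdeasL1Idea2R4
  (IsIsoPointTower IsoQuadraticTowerTerminates)

namespace Summit.ResolutionOfSingularities.ResolutionOfSingularities.Cruxes.SigmaMaxModifications.IdeasL1C5

universe u

/-! ## §1. A NON-DOMINATING COARSENING of a dominating valuation is a SHADOW: the overring `C = (B n₀)_{centre of O₁}`, the chain inside it,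
a unit of `C` in `𝔪(B n₀)`, and the RESIDUAL valuation ring of `O` on `κ(C)` dominating the images -/

section Coarsening

variable {L : Type u} [Field L]

/-- Units of a valuation ring are units of every coarsening. [folklore] -/
theorem valuation_eq_one_of_le {O O₁ : ValuationSubring L} (hle : O ≤ O₁) {z : L} (hz : O.valuation z = 1) :
    O₁.valuation z = 1 := by
  have hzO : z ∈ O := (O.valuation_le_one_iff z).mp hz.le
  have hz0 : z ≠ 0 := ne_zero_of_valuation_eq_one hz
  have hzi : z⁻¹ ∈ O := by rw [← O.valuation_le_one_iff, map_inv₀, hz, inv_one]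
  have h1 : O₁.valuation z ≤ 1 := (O₁.valuation_le_one_iff z).mpr (hle hzO)
  have h2 : O₁.valuation z⁻¹ ≤ 1 := (O₁.valuation_le_one_iff _).mpr (hle hzi)
  rw [map_inv₀, inv_le_one₀ (pos_iff_ne_zero.mpr ((map_ne_zero _).mpr hz0))] at h2
  exact le_antisymm h1 h2

/-- The maximal ideal of a coarsening lies in the finer valuation ring, indeed in its maximal ideal: `𝔪_{O₁} ⊆ 𝔪_O` for `O ≤ O₁`. [folklore] -/
theorem valuation_lt_one_of_le {O O₁ : ValuationSubring L} (hle : O ≤ O₁) {z : L} (hz : O₁.valuation z < 1) :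
    z ∈ O ∧ O.valuation z < 1 := by
  have hzO : z ∈ O := by
    by_contra hzO
    have hz0 : z ≠ 0 := fun h => hzO (h ▸ O.zero_mem)
    have hzi : z⁻¹ ∈ O := (O.mem_or_inv_mem z).resolve_left hzO
    have h1 : O₁.valuation z⁻¹ ≤ 1 := (O₁.valuation_le_one_iff _).mpr (hle hzi)
    rw [map_inv₀, inv_le_one₀ (pos_iff_ne_zero.mpr ((map_ne_zero _).mpr hz0))] at h1
    exact (not_le.mpr hz) h1
  refine ⟨hzO, lt_of_le_of_ne ((O.valuation_le_one_iff z).mpr hzO) fun h1 => ?_⟩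
  have := valuation_eq_one_of_le hle h1
  rw [this] at hz
  exact lt_irrefl _ hz

/-- Comparison of values passes to a coarsening: `v(a) ≤ v(b) ⇒ v₁(a) ≤ v₁(b)` for `O ≤ O₁`. [folklore] -/
theorem valuation_le_of_le {O O₁ : ValuationSubring L} (hle : O ≤ O₁) {a b : L} (h : O.valuation a ≤ O.valuation b) :
    O₁.valuation a ≤ O₁.valuation b := by
  rw [valuation_le_valuation_iff] at h ⊢
  exact ⟨h.1, fun hb => hle (h.2 hb)⟩

/-- A local subring `R ⊆ O₁` is NOT dominated by `O₁` iff some element of `𝔪(R)` is a unit of `O₁`. [cite: Cutkosky2014, §2.1] -/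
theorem exists_unit_of_not_dominates {R : Subring L} [IsLocalRing R] {O₁ : ValuationSubring L} (hRO₁ : R ≤ O₁.toSubring)
    (hnd : ¬ SubringDominates R O₁.toSubring) : ∃ x ∈ maximalIdeal R, O₁.valuation (x : L) = 1 := by
  by_contra hcon
  push Not at hcon
  apply hnd
  refine (subringDominates_valuationSubring_iff hRO₁).mpr fun a => ⟨fun ha => ?_, fun ha => ?_⟩
  · exact lt_of_le_of_ne ((O₁.valuation_le_one_iff _).mpr (hRO₁ a.2)) (hcon a ha)
  · rw [mem_maximalIdeal_iff_inv_not_mem]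
    by_cases h0 : (a : L) = 0
    · exact Or.inl h0
    · refine Or.inr fun hinv => ?_
      have h1 : O₁.valuation ((a : L)⁻¹) ≤ 1 := (O₁.valuation_le_one_iff _).mpr (hRO₁ hinv)
      rw [map_inv₀, inv_le_one₀ (pos_iff_ne_zero.mpr ((map_ne_zero _).mpr h0))] at h1
      exact (not_le.mpr ha) h1

variable {B : ℕ → Subring L} [hloc : ∀ n, IsLocalRing (B n)]
  (hdom : ∀ n, SubringDominates (B n) (B (n + 1)))
  (O : ValuationSubring L) (hO : ∀ n, SubringDominates (B n) O.toSubring)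
  (hQT : ∀ n, IsQuadraticTransformAlong O (B n) (B (n + 1)))
  (O₁ : ValuationSubring L) (hle : O ≤ O₁)

omit hloc in
include hdom hO hQT hle in
/-- **The chain stays inside the overring of a non-dominating coarsening.** `O` dominates the chain of quadratic transforms `B n` along it, `O₁ ⊇ O`
does NOT dominate `B n₀`; then every `B m` lies in `C = (B n₀)_{centre of O₁}`: for `m ≥ n₀` the generator `x_m` of `𝔪(B m)·B(m+1)` (of maximal
`O`-value) is a unit of `O₁` — otherwise every element of `𝔪(B m)` would have `O₁`-value `< 1` and `O₁` would dominate `B m ⊒ B n₀` —, so the chart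
`B m[𝔪/x_m]` and its localisation along `O` stay inside `C`. [cite: Cutkosky2014, §2.1, §2.2] [cite: ZariskiSamuel1960, Ch. VI §10] -/
theorem le_locAtCentre_of_not_dominates (n₀ : ℕ) (hnd : ¬ SubringDominates (B n₀) O₁.toSubring) (m : ℕ) :
    B m ≤ locAtCentre (B n₀) O₁ := by
  classical
  have hBO : ∀ n, B n ≤ O.toSubring := fun n => (hO n).1
  have hBO₁ : ∀ n, B n ≤ O₁.toSubring := fun n => (hBO n).trans hle
  set C := locAtCentre (B n₀) O₁ with hC
  have hCinv : ∀ z ∈ C, O₁.valuation z = 1 → z⁻¹ ∈ C := fun z hz hv => inv_mem_locAtCentre hz hv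
  have hnd' : ∀ m, n₀ ≤ m → ¬ SubringDominates (B m) O₁.toSubring :=
    fun m hm h => hnd ((subringDominates_of_le hdom hm).trans h)
  have hstep : ∀ m, n₀ ≤ m → B m ≤ C → B (m + 1) ≤ C := by
    intro m hm hBmC
    obtain ⟨_, x, hx, hx0, hxmax, hB⟩ := (hQT m).exists_eq_locAtCentre
    -- the generator is a unit of `O₁`
    have hxv : O₁.valuation (x : L) = 1 := by
      by_contra hne
      have hlt : O₁.valuation (x : L) < 1 := lt_of_le_of_ne ((O₁.valuation_le_one_iff _).mpr (hBO₁ m x.2)) hne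
      obtain ⟨a, ha, hav⟩ := exists_unit_of_not_dominates (hBO₁ m) (hnd' m hm)
      have h := valuation_le_of_le hle (hxmax a ha)
      rw [hav] at h
      exact (not_le.mpr hlt) h
    have hxC : (x : L) ∈ C := hBmC x.2
    have hxinv : (x : L)⁻¹ ∈ C := hCinv _ hxC hxv
    -- the chart lies in `C`
    have hchart : blowupRing (B m) (x : L) ≤ C := by
      rw [blowupRing, Subring.closure_le]
      rintro z (hz | ⟨y, -, rfl⟩)
      · exact hBmC hz
      · change (y : L) / x ∈ C
        rw [div_eq_mul_inv]
        exact C.mul_mem (hBmC y.2) hxinv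
    -- and so does its localisation along `O`
    rw [hB]
    rintro z ⟨y, hy, w, hw, hvw, rfl⟩
    rw [div_eq_mul_inv]
    exact C.mul_mem (hchart hy) (hCinv w (hchart hw) (valuation_eq_one_of_le hle hvw))
  have hge : ∀ i, B (n₀ + i) ≤ C := by
    intro i
    induction i with
    | zero => exact le_locAtCentre (B n₀) O₁
    | succ i ih => exact hstep (n₀ + i) (Nat.le_add_right n₀ i) ih
  rcases le_or_gt m n₀ with hm | hm
  · exact (le_of_le hdom hm).trans (le_locAtCentre (B n₀) O₁)
  · obtain ⟨i, rfl⟩ := Nat.exists_eq_add_of_le hm.le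
    exact hge i

omit hloc in
include hO hle in
/-- **The RESIDUAL valuation ring of `O` on `κ(C)`**, `C = (B n₀)_{centre of O₁}`: the residues of the elements of `C ∩ O` form a valuation ring of `κ(C)`
(composite valuations: `v = v₁ ∘ v̄`), which contains the residue of every element of `C ∩ O` and in which the residue of an element of `C ∩ 𝔪_O` is a
NON-unit. [cite: ZariskiSamuel1960, Ch. VI §10] -/
theorem exists_residual_valuationSubring (n₀ : ℕ) :
    letI := isLocalRing_locAtCentre ((hO n₀).1.trans hle)
    ∃ W : ValuationSubring (ResidueField (locAtCentre (B n₀) O₁)),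
      (∀ r, r ∈ W ↔ ∃ z : locAtCentre (B n₀) O₁, (z : L) ∈ O ∧ residue _ z = r) ∧
      (∀ z : locAtCentre (B n₀) O₁, (z : L) ∈ O → O.valuation (z : L) < 1 → W.valuation (residue _ z) < 1) := by
  classical
  have hBO₁ : B n₀ ≤ O₁.toSubring := (hO n₀).1.trans hle
  haveI hCloc := isLocalRing_locAtCentre hBO₁
  set C := locAtCentre (B n₀) O₁ with hC
  have hCO₁ : C ≤ O₁.toSubring := locAtCentre_le hBO₁
  have hmaxC : ∀ z : C, z ∈ maximalIdeal C ↔ O₁.valuation (z : L) < 1 := fun z => mem_maximalIdeal_locAtCentre_iff hBO₁ z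
  let W : ValuationSubring (ResidueField C) :=
    { carrier := {r | ∃ z : C, (z : L) ∈ O ∧ residue C z = r}
      mul_mem' := by
        rintro _ _ ⟨z₁, h₁, rfl⟩ ⟨z₂, h₂, rfl⟩
        exact ⟨z₁ * z₂, O.mul_mem _ _ h₁ h₂, map_mul _ _ _⟩
      one_mem' := ⟨1, O.one_mem, map_one _⟩
      add_mem' := by
        rintro _ _ ⟨z₁, h₁, rfl⟩ ⟨z₂, h₂, rfl⟩
        exact ⟨z₁ + z₂, O.add_mem _ _ h₁ h₂, map_add _ _ _⟩
      zero_mem' := ⟨0, O.zero_mem, map_zero _⟩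
      neg_mem' := by
        rintro _ ⟨z, h, rfl⟩
        exact ⟨-z, O.neg_mem _ h, map_neg _ _⟩
      mem_or_inv_mem' := by
        intro r
        obtain ⟨z, rfl⟩ := IsLocalRing.residue_surjective r
        by_cases hzO : (z : L) ∈ O
        · exact Or.inl ⟨z, hzO, rfl⟩
        · right
          -- `z ∉ O`: then `O₁.val z = 1` (else `z ∈ 𝔪_{O₁} ⊆ O`), so `z⁻¹ ∈ C ∩ O`
          have hz0 : (z : L) ≠ 0 := fun h => hzO (h ▸ O.zero_mem)
          have hv1 : O₁.valuation (z : L) = 1 := by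
            by_contra hne
            exact hzO (valuation_lt_one_of_le hle (lt_of_le_of_ne ((O₁.valuation_le_one_iff _).mpr (hCO₁ z.2)) hne)).1
          have hziC : (z : L)⁻¹ ∈ C := inv_mem_locAtCentre z.2 hv1
          have hziO : (z : L)⁻¹ ∈ O := (O.mem_or_inv_mem _).resolve_left hzO
          refine ⟨⟨(z : L)⁻¹, hziC⟩, hziO, ?_⟩
          have hmul : z * ⟨(z : L)⁻¹, hziC⟩ = 1 := Subtype.ext (mul_inv_cancel₀ hz0)
          rw [eq_comm, inv_eq_of_mul_eq_one_right]
          rw [← map_mul, hmul, map_one] }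
  refine ⟨W, fun r => Iff.rfl, fun z hzO hzv => ?_⟩
  -- the residue of an element of `𝔪_O ∩ C` is a non-unit of `W`
  have hmem : residue C z ∈ W := ⟨z, hzO, rfl⟩
  have key : (⟨residue C z, hmem⟩ : W) ∈ maximalIdeal W := by
    rw [IsLocalRing.mem_maximalIdeal, mem_nonunits_iff]
    rintro ⟨u, hu⟩
    obtain ⟨w, hwO, hw⟩ : ((↑u⁻¹ : W) : ResidueField C) ∈ W := (↑u⁻¹ : W).2
    have h1 : residue C (z * w) = 1 := by
      rw [map_mul, hw]
      have := congrArg (fun t : W => (t : ResidueField C)) u.mul_inv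
      simpa [hu] using this
    -- `z * w - 1 ∈ 𝔪_C`, so it has `O₁`-value `< 1`, hence `O`-value `< 1`; but `O.val (z w) < 1`: contradiction
    have h2 : z * w - 1 ∈ maximalIdeal C := by
      rw [← residue_eq_zero_iff, map_sub, h1, map_one, sub_self]
    have h3 := (valuation_lt_one_of_le hle ((hmaxC _).mp h2)).2
    have h4 : O.valuation ((z : L) * w) < 1 := by
      rw [map_mul]
      calc O.valuation (z : L) * O.valuation (w : L) ≤ O.valuation (z : L) * 1 :=
            mul_le_mul_right ((O.valuation_le_one_iff _).mpr hwO) _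
        _ < 1 := by rw [mul_one]; exact hzv
    have h5 : O.valuation (1 : L) < 1 := by
      have : (1 : L) = (z : L) * w - (((z * w - 1 : C) : L)) := by push_cast; ring
      rw [this]
      exact lt_of_le_of_lt (Valuation.map_sub _ _ _) (max_lt h4 h3)
    rw [map_one] at h5
    exact lt_irrefl _ h5
  exact (ValuationSubring.valuation_lt_one_iff W _).mp key

end Coarsening

/-! ## §2. Scheme level: the census EXHAUSTION STEP over a perfect ground field — a coarsening of a dominating valuation either dominates (then it
is not Noetherian, `…PerfectNoetherian`) or shadows the tower, and then its RESIDUAL valuation ring is not Noetherian -/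

section Scheme

open Scheme.IdealSheafData

variable {p : ℕ} {ν : ℕ → ℕ} {T : BlowupTower.{u}} {hint : ∀ n, IsIntegral (T.X n)} {pt : ∀ n, T.X n}

/-- Along the tower, every step is the quadratic transform along ANY valuation ring dominating the tower (gen 5's one-step dictionary
`isQuadraticTransformAlong_range_of_stalk_embeddings` at the marked points). [cite: Cutkosky2014, §2.2] -/
theorem isQuadraticTransformAlong_of_dominatesTower (hC : ∀ n, T.C n = {pt n}) (hpt : ∀ n, (T.π n).base (pt (n + 1)) = pt n)
    (hcl : ∀ n, IsClosed ({pt n} : Set (T.X n))) (O : ValuationSubring (T.X 0).functionField) (hdomT : DominatesTower T hint pt O) (n : ℕ) :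
    IsQuadraticTransformAlong O (towerStalkEmb T hint n (pt n)).range (towerStalkEmb T hint (n + 1) (pt (n + 1))).range := by
  haveI := hint
  haveI := fun n => T.ln n
  have hJ : stalkIdeal (vanishingIdeal ⟨T.C n, T.isClosed_C n⟩) ((T.π n) (pt (n + 1))) =
      maximalIdeal ((T.X n).presheaf.stalk ((T.π n) (pt (n + 1)))) := by
    refine stalkIdeal_vanishingIdeal_eq_maximalIdeal_of_closure_eq ?_
    change T.C n = closure {(T.π n).base (pt (n + 1))}
    rw [hpt n, (hcl n).closure_eq, hC n]
  have hstep := isQuadraticTransformAlong_range_of_stalk_embeddings (L := (T.X 0).functionField) (T.isBlowup n) (pt (n + 1)) hJ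
    ((towerStalkEmb T hint n (pt n)).comp ((T.X n).presheaf.stalkCongr (.of_eq (hpt n))).hom.hom)
    (injective_comp_stalkCongr hpt (fun n => towerStalkEmb T hint n (pt n)) (fun n => towerStalkEmb_injective T hint n _) n)
    (towerStalkEmb T hint (n + 1) (pt (n + 1))) (towerStalkEmb_comp_stalkMap_pt T hint hpt n) O (hdomT (n + 1))
  rwa [range_comp_stalkCongr hpt (fun n => towerStalkEmb T hint n (pt n)) n] at hstep

/-- **CENSUS EXHAUSTION STEP (perfect ground field).** An isolated E3 point tower over a maximal origin (integral stages; origin stage separated,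
quasi-compact, locally of finite type over a perfect field of characteristic `p`), `O` a valuation ring DOMINATING the tower and `O₁ ⊇ O` a
COARSENING which does NOT dominate the stage-`n₀` local ring. Then the RESIDUAL valuation ring of `O` on the residue field of
`C = (𝒪_{X_{n₀},x_{n₀}})_{centre of O₁}` (the local ring of the subvariety that `O₁` is centred on — a curve or a surface through every later `x_n`)
is NOT Noetherian. (Together with `…PerfectNoetherian` for dominating coarsenings: every rank-one valuation met when unscrewing a dominating `O` has
DENSE value group.) Proof: `le_locAtCentre_of_not_dominates` + `exists_residual_valuationSubring` feed `eventually_not_satellite_of_overring_noetherian`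
on the chain from `n₀` on; the tower is satellite-recurrent (`satelliteRecurrent_of_isIsoPointTower_over_perfectField`).
[cite: ZariskiSamuel1960, Ch. VI §10, App. 5] [cite: CossartPiltant2009, ch. 3 I.9, ch. 4 II.4] -/
theorem false_of_isIsoPointTower_over_perfectField_of_coarsening_noetherian_residual
    {k : Type u} [Field k] [CharP k p] [PerfectField k] (f : T.X 0 ⟶ Spec (.of k)) [IsSeparated f] [LocallyOfFiniteType f] [QuasiCompact f]
    (hO : IsMaximalOrigin p 3 ν (T.X 0) (pt 0)) (hT : IsIsoPointTower 3 ν T pt)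
    (O : ValuationSubring (T.X 0).functionField) (hdomT : DominatesTower T hint pt O)
    (O₁ : ValuationSubring (T.X 0).functionField) (hle : O ≤ O₁) (n₀ : ℕ)
    (hnd : ¬ SubringDominates (towerStalkEmb T hint n₀ (pt n₀)).range O₁.toSubring)
    [hCloc : IsLocalRing (locAtCentre (towerStalkEmb T hint n₀ (pt n₀)).range O₁)]
    (hWN : ∀ W : ValuationSubring (ResidueField (locAtCentre (towerStalkEmb T hint n₀ (pt n₀)).range O₁)),
      (∀ r, r ∈ W ↔ ∃ z : locAtCentre (towerStalkEmb T hint n₀ (pt n₀)).range O₁, (z : (T.X 0).functionField) ∈ O ∧ residue _ z = r) →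
        IsNoetherianRing W) : False := by
  haveI := hint
  haveI := fun n => T.ln n
  set Θ := towerStalkEmb T hint with hΘ
  haveI hB : ∀ n (y : T.X n), IsLocalRing (Θ n y).range := fun n y => isLocalRing_of_range_eq (Θ n y) _ rfl
  have hdom : ∀ n, SubringDominates (Θ n (pt n)).range (Θ (n + 1) (pt (n + 1))).range :=
    subringDominates_range_succ hT.2.1 (fun n => Θ n (pt n)) (fun n => towerStalkEmb_injective T hint n _)
      (towerStalkEmb_comp_stalkMap_pt T hint hT.2.1)
  have hQT : ∀ n, IsQuadraticTransformAlong O (Θ n (pt n)).range (Θ (n + 1) (pt (n + 1))).range :=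
    isQuadraticTransformAlong_of_dominatesTower hT.1 hT.2.1 hT.2.2.1 O hdomT
  have hprin : ∀ n, ∃ t ∈ maximalIdeal (Θ n (pt n)).range, ∀ x ∈ maximalIdeal (Θ n (pt n)).range,
      ∃ y : (Θ (n + 1) (pt (n + 1))).range, (x : (T.X 0).functionField) = y * t := by
    intro n
    obtain ⟨_, hLB⟩ := hQT n
    obtain ⟨u₀, hu₀, hgen⟩ := hLB.exists_span_singleton
    exact ⟨u₀, hu₀, fun x hx => by obtain ⟨y, hy, hxy⟩ := hgen x hx; exact ⟨⟨y, hy⟩, hxy⟩⟩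
  have hBO : ∀ n, (Θ n (pt n)).range ≤ O.toSubring := fun n => (hdomT n).1
  have hBO₁ : ∀ n, (Θ n (pt n)).range ≤ O₁.toSubring := fun n => (hBO n).trans hle
  set C := locAtCentre (Θ n₀ (pt n₀)).range O₁ with hC
  have hmaxC : ∀ z : C, z ∈ maximalIdeal C ↔ O₁.valuation (z : (T.X 0).functionField) < 1 :=
    fun z => mem_maximalIdeal_locAtCentre_iff (hBO₁ n₀) z
  -- the shadow data
  have hBC : ∀ m, (Θ m (pt m)).range ≤ C := le_locAtCentre_of_not_dominates hdom O hdomT hQT O₁ hle n₀ hnd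
  obtain ⟨x, hx, hxv⟩ := exists_unit_of_not_dominates (hBO₁ n₀) hnd
  obtain ⟨W, hWchar, hWdom0⟩ := exists_residual_valuationSubring (B := fun n => (Θ n (pt n)).range) O hdomT O₁ hle n₀
  haveI := hWN W hWchar
  -- the chain from stage `n₀` on, read in `κ(C)`
  have hdom' : ∀ i, SubringDominates (Θ (n₀ + i) (pt (n₀ + i))).range (Θ (n₀ + i + 1) (pt (n₀ + i + 1))).range :=
    fun i => hdom (n₀ + i)
  have hBC' : ∀ i, (Θ (n₀ + i) (pt (n₀ + i))).range ≤ C := fun i => hBC (n₀ + i)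
  have hprin' : ∀ i, ∃ t ∈ maximalIdeal (Θ (n₀ + i) (pt (n₀ + i))).range, ∀ x ∈ maximalIdeal (Θ (n₀ + i) (pt (n₀ + i))).range,
      ∃ y : (Θ (n₀ + i + 1) (pt (n₀ + i + 1))).range, (x : (T.X 0).functionField) = y * t := fun i => hprin (n₀ + i)
  have hsep' : ∃ x ∈ maximalIdeal (Θ (n₀ + 0) (pt (n₀ + 0))).range, Subring.inclusion (hBC' 0) x ∉ maximalIdeal C :=
    ⟨x, hx, fun h => by
      have h1 := (hmaxC _).mp h
      change O₁.valuation (x : (T.X 0).functionField) < 1 at h1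
      rw [hxv] at h1; exact lt_irrefl _ h1⟩
  have hW' : ∀ i (x : (Θ (n₀ + i) (pt (n₀ + i))).range), residue C (Subring.inclusion (hBC' i) x) ∈ W :=
    fun i x => (hWchar _).mpr ⟨_, hBO (n₀ + i) x.2, rfl⟩
  have hWdom' : ∀ i (x : (Θ (n₀ + i) (pt (n₀ + i))).range), x ∈ maximalIdeal _ →
      W.valuation (residue C (Subring.inclusion (hBC' i) x)) < 1 := by
    intro i x hx
    refine hWdom0 _ (hBO (n₀ + i) x.2) ?_
    exact ((subringDominates_valuationSubring_iff (hBO (n₀ + i))).mp (hdomT (n₀ + i)) x).mp hx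
  obtain ⟨i₀, hi₀⟩ := eventually_not_satellite_of_overring_noetherian (B := fun i => (Θ (n₀ + i) (pt (n₀ + i))).range)
    hdom' C hBC' hprin' hsep' W hW' hWdom'
  obtain ⟨n, hn, hsat⟩ := satelliteRecurrent_of_isIsoPointTower_over_perfectField f hO hT (n₀ + i₀)
  obtain ⟨i, rfl⟩ := Nat.exists_eq_add_of_le hn
  have h := hi₀ (i₀ + i) (Nat.le_add_right i₀ i)
  rw [show n₀ + i₀ + i = n₀ + (i₀ + i) from Nat.add_assoc n₀ i₀ i] at hsat
  exact not_isSatelliteStep_of_range_form hT.2.1 (n₀ + (i₀ + i)) h hsat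

end Scheme

end Summit.ResolutionOfSingularities.ResolutionOfSingularities.Cruxes.SigmaMaxModifications.IdeasL1C5

end
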